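import Summits.QuantumFields.BalabanUV.Beta.AxialDressingRootedLinear

/-!
# The axial COORDINATE projector `E` and rules 1–2 of the relative inverse: `E ∘ G_j = G_j = G_j ∘ E`
# (β sub-cell, row BETA-an2, gen 12; item (ii-1), statement side, of NOTE X-an2-41 §4)

HONEST FRAMING (cell charter, verbatim): «discharging BetaPertH makes Balaban's UV stability UNCONDITIONAL — a real
constructive-QFT result; it is NOT the continuum limit and NOT the Clay problem.»  DERIVED cell leaf (pub-balaban β sub-cell, lane
an2 gen 12); no statement of Bałaban's papers is typed here, no `[cite:]` tag, no `Prop` fact (`IsCombBondAt` is a predicate on a bond);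
it instantiates no binder of the β-function wall by itself.  NOT `BetaPertH`; NOT continuum; NOT Clay.

## What is here

The relative sockets of `ChartConjugationRelative.RelInv G 𝕄 E` ask four rules of the co-dressed step resolvent
`G_j = coDressKAt ρ Lc (KInvStep Lc j)`.  Two of them — `E∘G = G`, `G∘E = G` — say only that `G` lives on the range of the axial
COORDINATE projector; they hold for EVERY in-block root and every spread `K`, because the rooted comb projector's range vanishes
on the comb bonds.  This file proves exactly that:
* §1 `seg_sum_succ`, `axialAux_sum_eq` (an1's contour as a finite sum of segment sums), the comb-bond predicate
  `IsCombBondAt ρ N m p` (coordinates below the axis at the root, the bond inside one block), **`treeGaugeAt_step_of_isCombBond`**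
  (`λ^ρ_A(p + e_m) − λ^ρ_A(p) = A_m(p)` on comb bonds), **`axProjAt_eq_zero_of_isCombBond`** (`(Π^ρ A)_m(p) = 0` on comb bonds, EVERY `A`)
  and `pm_eq_zero_of_isCombBond`;
* §2 THE COORDINATE PROJECTOR KERNEL `axE ρ N` (field block: the diagonal indicator of NON-comb bonds; multiplier block: identity),
  `decays_axE` (every rate, constant 1), `spr_axE`, `trK_axE`, `axE_idem`-free facts used downstream;
* §3 **`comp_axE_trK_piK : comp (axE ρ N) (trK (piK ρ N)) = trK (piK ρ N)`**, **`comp_piK_axE : comp (piK ρ N) (axE ρ N) = piK ρ N`**, hence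
  **`comp_axE_coDressKAt`**, **`comp_coDressKAt_axE`**: RULES 1–2 of `RelInv (coDressKAt (toSite r) N K) 𝕄 (axE (toSite r) N)` for every
  spread `K` and every `𝕄` (rules 3–4 — that `G` inverts the undressed bordered Hessian on that range — are NOT here: no supplier of `𝕄`).

All declarations `[folklore]` (list bookkeeping, finite sums, tame associativity); axioms standard.
Provenance: b2b-balaban β sub-cell, unit beta-an2 gen 12, 2026-08-19 (v1); over parts 4–5 of the rooted dressing, an1's
`AveragingContours(Rooted)`, an5's `RootedComb` / `TameKernelCalculus` BY NAME; no existing file touched.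
-/

open Finset
open scoped BigOperators
open Literature.MathematicalPhysics.QuantumFieldTheory
open Literature.MathematicalPhysics.QuantumFieldTheory.Balaban1983to89
open Literature.MathematicalPhysics.QuantumFieldTheory.Balaban1983to89.Beta
open B12Sec2to5 (l1 l1_nonneg)
open ExpKernelCalculus (MKer Decays BiLoc comp tr shiftK)
open AffineAveraging (Form0 Form1 box toSite unitVec unitVec_apply)
open AveragingContours (blk segUp segDown seg corner axialAux axial grad)
open AveragingContoursRooted (treeGaugeAt)
open RootedComb (axProjAt axProjAt_apply)
open OneStepResolventKernel (Fib)
open Summit.QuantumFields.BalabanUV.Beta.TameKernelCalculus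

namespace Summit.QuantumFields.BalabanUV.Beta.AxialDressingRooted

noncomputable section

variable {n : ℕ}

/-! ## §1 Comb bonds: the rooted projector's range vanishes on them -/

section Comb

variable {R : Type*} [AddCommGroup R]

/-- [folklore] One more bond on a straight segment: `Σ seg(k+1) = Σ seg(k) + A_κ(z + k e_κ)` for every integer `k` (up AND down). -/
theorem seg_sum_succ (A : Form1 n R) (z : Fin n → ℤ) (κ : Fin n) (k : ℤ) :
    (seg A z κ (k + 1)).sum = (seg A z κ k).sum + A κ (z + k • unitVec κ) := by
  unfold AveragingContours.seg
  by_cases hk : 0 ≤ k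
  · have hk1 : 0 ≤ k + 1 := by omega
    rw [if_pos hk1, if_pos hk, show (k + 1).toNat = k.toNat + 1 by omega, AveragingContours.segUp_succ, List.sum_append,
      List.sum_singleton, show ((k.toNat : ℕ) : ℤ) = k from Int.toNat_of_nonneg hk]
  · have hk' : k < 0 := not_le.1 hk
    by_cases hk1 : 0 ≤ k + 1
    · have hk0 : k = -1 := by omega
      subst hk0
      rw [if_pos hk1, if_neg hk]
      norm_num [AveragingContours.segDown_succ]
      rw [sub_eq_add_neg, ← neg_one_smul ℤ (unitVec κ)]
      abel
    · rw [if_neg hk1, if_neg hk]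
      have e1 : (-k).toNat = (-(k + 1)).toNat + 1 := by omega
      rw [e1, AveragingContours.segDown_succ, List.sum_append, List.sum_singleton]
      have e2 : (((-(k + 1)).toNat : ℕ) : ℤ) + 1 = -k := by omega
      rw [e2, neg_smul, sub_neg_eq_add]
      abel

/-- [folklore] The partial axial contour's sum is the sum of its segment sums. -/
theorem axialAux_sum_eq (A : Form1 n R) (y x : Fin n → ℤ) :
    ∀ M, (axialAux A y x M).sum =
      ∑ m ∈ Finset.range M, (if h : m < n then (seg A (corner y x (m + 1)) ⟨m, h⟩ (x ⟨m, h⟩ - y ⟨m, h⟩)).sum else 0)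
  | 0 => by simp [axialAux]
  | M + 1 => by
    rw [Finset.sum_range_succ, ← axialAux_sum_eq A y x M]
    simp only [axialAux, List.sum_append]
    by_cases h : M < n
    · rw [dif_pos h, dif_pos h, add_comm]
    · rw [dif_neg h, dif_neg h, List.sum_nil, zero_add, add_zero]

/-- [folklore] **COMB BOND** of the block lattice with root offset `ρ` (axis order `0 < 1 < … `, the contour moving the highest axis first):
the bond `[p, p + e_m]` lies on the rooted comb of its block iff the coordinates of `p` BELOW `m` are at the root and `p + e_m` is in the
block of `p`. -/
def IsCombBondAt (ρ : Fin n → ℤ) (N : ℕ) (m : Fin n) (p : Fin n → ℤ) : Prop :=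
  (∀ j : Fin n, j < m → p j = ((N : ℤ) • blk N p) j + ρ j) ∧ blk N (p + unitVec m) = blk N p

/-- [folklore] **THE TREE INTEGRAL STEPS BY `A_m(p)` ACROSS A COMB BOND**: `λ^ρ_A(p + e_m) − λ^ρ_A(p) = A_m(p)` — the two contours share
every segment except the one along `m`, which is one bond longer. -/
theorem treeGaugeAt_step_of_isCombBond {ρ : Fin n → ℤ} {N : ℕ} {m : Fin n} {p : Fin n → ℤ} (h : IsCombBondAt ρ N m p)
    (A : Form1 n R) : treeGaugeAt ρ A N (p + unitVec m) - treeGaugeAt ρ A N p = A m p := by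
  obtain ⟨hlow, hblk⟩ := h
  set y : Fin n → ℤ := (N : ℤ) • blk N p + ρ with hy
  unfold treeGaugeAt
  rw [hblk]
  show (axial A y (p + unitVec m)).sum - (axial A y p).sum = A m p
  unfold AveragingContours.axial
  rw [axialAux_sum_eq, axialAux_sum_eq, ← Finset.sum_sub_distrib]
  -- every term vanishes except `m`
  rw [Finset.sum_eq_single (m : ℕ)]
  · -- the term `m`
    rw [dif_pos m.2, dif_pos m.2]
    have ec : corner y (p + unitVec m) ((m : ℕ) + 1) = corner y p ((m : ℕ) + 1) := by
      funext j
      simp only [corner]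
      split_ifs with hj
      · have hjm : j ≠ m := fun e => by subst e; omega
        simp [hjm]
      · rfl
    have em : (⟨(m : ℕ), m.2⟩ : Fin n) = m := rfl
    rw [ec, em]
    have el : (p + unitVec m) m - y m = (p m - y m) + 1 := by simp; ring
    rw [el, seg_sum_succ]
    have ep : corner y p ((m : ℕ) + 1) + (p m - y m) • unitVec m = p := by
      funext j
      simp only [corner, Pi.add_apply, Pi.smul_apply, unitVec_apply, smul_eq_mul]
      by_cases hjm : j = m
      · subst hjm; simp
      · rw [if_neg hjm, mul_zero, add_zero]
        split_ifs with hj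
        · rfl
        · have hlt : j < m := by
            have : (j : ℕ) ≠ (m : ℕ) := fun e => hjm (Fin.ext e)
            exact Fin.lt_def.2 (by omega)
          rw [hlow j hlt, hy, Pi.add_apply]
    rw [ep]
    abel
  · -- the other terms vanish
    intro m' _ hm'
    by_cases h' : m' < n
    · rw [dif_pos h', dif_pos h']
      by_cases hlt : m' < (m : ℕ)
      · -- below `m`: both segments are empty
        have hj : (⟨m', h'⟩ : Fin n) < m := Fin.lt_def.2 hlt
        have e0 : p ⟨m', h'⟩ - y ⟨m', h'⟩ = 0 := by rw [hlow _ hj, hy, Pi.add_apply, sub_self]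
        have e0' : (p + unitVec m) ⟨m', h'⟩ - y ⟨m', h'⟩ = 0 := by
          have hne : (⟨m', h'⟩ : Fin n) ≠ m := fun e => hm' (by rw [← e])
          simp only [Pi.add_apply, unitVec_apply, if_neg hne, add_zero]
          exact e0
        rw [e0, e0']
        simp [AveragingContours.seg]
      · -- above `m`: identical segments
        have hgt : (m : ℕ) < m' := by omega
        have hne : (⟨m', h'⟩ : Fin n) ≠ m := fun e => hm' (by rw [← e])
        have ec : corner y (p + unitVec m) (m' + 1) = corner y p (m' + 1) := by
          funext j
          simp only [corner]
          split_ifs with hj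
          · have hjm : j ≠ m := fun e => by subst e; omega
            simp [hjm]
          · rfl
        rw [ec]
        simp only [Pi.add_apply, unitVec_apply, if_neg hne, add_zero, sub_self]
    · rw [dif_neg h', dif_neg h', sub_self]
  · intro hm
    exact absurd (Finset.mem_range.2 m.2) hm

/-- [folklore] **THE ROOTED PROJECTOR'S RANGE VANISHES ON COMB BONDS**: `(Π^ρ A)_m(p) = 0` for every one-form `A`. -/
theorem axProjAt_eq_zero_of_isCombBond {ρ : Fin n → ℤ} {N : ℕ} {m : Fin n} {p : Fin n → ℤ} (h : IsCombBondAt ρ N m p)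
    (A : Form1 n R) : axProjAt ρ N A m p = 0 := by
  rw [axProjAt_apply, treeGaugeAt_step_of_isCombBond h A, sub_self]

/-- [folklore] In particular the projector MATRIX vanishes on comb legs: `pm ρ N β p α q = 0` for a comb bond `(β, p)`. -/
theorem pm_eq_zero_of_isCombBond {ρ : Fin n → ℤ} {N : ℕ} {β : Fin n} {p : Fin n → ℤ} (h : IsCombBondAt ρ N β p) (α : Fin n)
    (q : Fin n → ℤ) : pm ρ N β p α q = 0 := by
  rw [pm_eq]
  exact axProjAt_eq_zero_of_isCombBond h (bondInd α q)

end Comb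

/-! ## §2 The axial coordinate projector kernel `axE ρ N` -/

section AxE

variable {d : ℕ}

open Classical in
/-- [folklore] **THE AXIAL COORDINATE PROJECTOR KERNEL** `axE ρ N`: on the field block the diagonal indicator of the NON-comb bonds
(`[x = x′ ∧ α = β ∧ (α, x) not a comb bond]`), on the multiplier block the identity, mixed blocks zero — the orthogonal projector onto
the hard axial gauge `{A : A = 0 on comb bonds}` (the range of the rooted comb projector), packed with the multipliers. -/
def axE (ρ : Fin (d + 1) → ℤ) (N : ℕ) : MKer (d + 1) (Fib d) :=
  fun x x' a b =>
    match a, b with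
    | Sum.inl α, Sum.inl β => if x = x' ∧ α = β ∧ ¬ IsCombBondAt ρ N α x then 1 else 0
    | Sum.inl _, Sum.inr _ => 0
    | Sum.inr _, Sum.inl _ => 0
    | Sum.inr m, Sum.inr m' => if x = x' ∧ m = m' then 1 else 0

variable (ρ : Fin (d + 1) → ℤ) (N : ℕ)

open Classical in
/-- [folklore] Field–field entry of `axE`. -/
theorem axE_inl_inl (x x' : Fin (d + 1) → ℤ) (α β : Fin (d + 1)) :
    axE ρ N x x' (Sum.inl α) (Sum.inl β) = if x = x' ∧ α = β ∧ ¬ IsCombBondAt ρ N α x then 1 else 0 := rfl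

/-- [folklore] Field–multiplier entry of `axE` vanishes. -/
theorem axE_inl_inr (x x' : Fin (d + 1) → ℤ) (α m : Fin (d + 1)) : axE ρ N x x' (Sum.inl α) (Sum.inr m) = 0 := rfl

/-- [folklore] Multiplier–field entry of `axE` vanishes. -/
theorem axE_inr_inl (x x' : Fin (d + 1) → ℤ) (m α : Fin (d + 1)) : axE ρ N x x' (Sum.inr m) (Sum.inl α) = 0 := rfl

/-- [folklore] Multiplier–multiplier entry of `axE` is the identity. -/
theorem axE_inr_inr (x x' : Fin (d + 1) → ℤ) (m m' : Fin (d + 1)) :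
    axE ρ N x x' (Sum.inr m) (Sum.inr m') = if x = x' ∧ m = m' then 1 else 0 := rfl

/-- [folklore] `axE` is diagonal with entries in `{0, 1}`, so it decays at EVERY rate with constant `1`. -/
theorem decays_axE (δ : ℝ) : Decays (axE ρ N) 1 δ := by
  intro x x' a b
  have hdiag : x = x' → (1 : ℝ) * Real.exp (-δ * l1 (x - x')) = 1 := fun h => by
    subst h
    have h0 : l1 (0 : Fin (d + 1) → ℤ) = 0 := by simp [l1]
    rw [sub_self, h0, mul_zero, Real.exp_zero, mul_one]
  have hpos : (0 : ℝ) ≤ 1 * Real.exp (-δ * l1 (x - x')) := by positivity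
  rcases a with α | m <;> rcases b with β | m'
  · rw [axE_inl_inl]
    split_ifs with h
    · rw [hdiag h.1, abs_one]
    · rw [abs_zero]; exact hpos
  · rw [axE_inl_inr, abs_zero]; exact hpos
  · rw [axE_inr_inl, abs_zero]; exact hpos
  · rw [axE_inr_inr]
    split_ifs with h
    · rw [hdiag h.1, abs_one]
    · rw [abs_zero]; exact hpos

/-- [folklore] `axE` is spread. -/
theorem spr_axE : Spr (axE ρ N) := ⟨1, 1, one_pos, decays_axE ρ N 1⟩

open Classical in
/-- [folklore] LEFT ACTION of `axE`: it kills the comb rows of the field block and fixes everything else. -/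
theorem comp_axE_apply (X : MKer (d + 1) (Fib d)) (x x' : Fin (d + 1) → ℤ) (a b : Fib d) :
    comp (axE ρ N) X x x' a b =
      match a with
      | Sum.inl α => if IsCombBondAt ρ N α x then 0 else X x x' a b
      | Sum.inr _ => X x x' a b := by
  unfold ExpKernelCalculus.comp
  rcases a with α | m
  · have h : ∀ y, ∑ f : Fib d, axE ρ N x y (Sum.inl α) f * X y x' f b =
        if x = y then (if IsCombBondAt ρ N α x then 0 else X y x' (Sum.inl α) b) else 0 := by
      intro y
      rw [Fintype.sum_sum_type]
      simp only [axE_inl_inr, zero_mul, Finset.sum_const_zero, add_zero]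
      rw [Finset.sum_eq_single α (fun β _ hβ => by rw [axE_inl_inl, if_neg (fun h => hβ h.2.1.symm), zero_mul])
        (fun h => absurd (Finset.mem_univ _) h), axE_inl_inl]
      by_cases hy : x = y
      · by_cases hc : IsCombBondAt ρ N α x
        · rw [if_neg (fun h => h.2.2 hc), zero_mul, if_pos hy, if_pos hc]
        · rw [if_pos ⟨hy, rfl, hc⟩, one_mul, if_pos hy, if_neg hc]
      · rw [if_neg (fun h => hy h.1), zero_mul, if_neg hy]
    simp_rw [h]
    rw [tsum_point]
  · have h : ∀ y, ∑ f : Fib d, axE ρ N x y (Sum.inr m) f * X y x' f b = if x = y then X y x' (Sum.inr m) b else 0 := by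
      intro y
      rw [Fintype.sum_sum_type]
      simp only [axE_inr_inl, zero_mul, Finset.sum_const_zero, zero_add]
      rw [Finset.sum_eq_single m (fun m' _ hm' => by rw [axE_inr_inr, if_neg (fun h => hm' h.2.symm), zero_mul])
        (fun h => absurd (Finset.mem_univ _) h), axE_inr_inr]
      by_cases hy : x = y
      · rw [if_pos ⟨hy, rfl⟩, one_mul, if_pos hy]
      · rw [if_neg (fun h => hy h.1), zero_mul, if_neg hy]
    simp_rw [h]
    rw [tsum_point]

open Classical in
/-- [folklore] RIGHT ACTION of `axE`: it kills the comb columns of the field block and fixes everything else. -/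
theorem comp_axE_apply' (X : MKer (d + 1) (Fib d)) (x x' : Fin (d + 1) → ℤ) (a b : Fib d) :
    comp X (axE ρ N) x x' a b =
      match b with
      | Sum.inl β => if IsCombBondAt ρ N β x' then 0 else X x x' a b
      | Sum.inr _ => X x x' a b := by
  unfold ExpKernelCalculus.comp
  rcases b with β | m
  · have h : ∀ y, ∑ f : Fib d, X x y a f * axE ρ N y x' f (Sum.inl β) =
        if y = x' then (if IsCombBondAt ρ N β x' then 0 else X x y a (Sum.inl β)) else 0 := by
      intro y
      rw [Fintype.sum_sum_type]
      simp only [axE_inr_inl, mul_zero, Finset.sum_const_zero, add_zero]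
      rw [Finset.sum_eq_single β (fun β' _ hβ => by rw [axE_inl_inl, if_neg (fun h => hβ h.2.1), mul_zero])
        (fun h => absurd (Finset.mem_univ _) h), axE_inl_inl]
      by_cases hy : y = x'
      · have hcc : IsCombBondAt ρ N β y ↔ IsCombBondAt ρ N β x' := by rw [hy]
        by_cases hc : IsCombBondAt ρ N β x'
        · rw [if_neg (fun h => h.2.2 (hcc.2 hc)), mul_zero, if_pos hy, if_pos hc]
        · rw [if_pos ⟨hy, rfl, fun h' => hc (hcc.1 h')⟩, mul_one, if_pos hy, if_neg hc]
      · rw [if_neg (fun h => hy h.1), mul_zero, if_neg hy]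
    simp_rw [h]
    rw [tsum_point']
  · have h : ∀ y, ∑ f : Fib d, X x y a f * axE ρ N y x' f (Sum.inr m) = if y = x' then X x y a (Sum.inr m) else 0 := by
      intro y
      rw [Fintype.sum_sum_type]
      simp only [axE_inl_inr, mul_zero, Finset.sum_const_zero, zero_add]
      rw [Finset.sum_eq_single m (fun m' _ hm' => by rw [axE_inr_inr, if_neg (fun h => hm' h.2), mul_zero])
        (fun h => absurd (Finset.mem_univ _) h), axE_inr_inr]
      by_cases hy : y = x'
      · rw [if_pos ⟨hy, rfl⟩, mul_one, if_pos hy]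
      · rw [if_neg (fun h => hy h.1), mul_zero, if_neg hy]
    simp_rw [h]
    rw [tsum_point']

/-- [folklore] **`axE ∘ Πᵀ-matrix = Πᵀ-matrix`** (`trK piK` = the matrix of `Π_ρ` in kernel form): the rooted projector's range has no
comb rows (`pm_eq_zero_of_isCombBond`). -/
theorem comp_axE_trK_piK : comp (axE ρ N) (trK (piK ρ N)) = trK (piK ρ N) := by
  funext x x' a b
  rw [comp_axE_apply]
  rcases a with α | m
  · dsimp only
    split_ifs with hc
    · show (0 : ℝ) = piK ρ N x' x b (Sum.inl α)
      rcases b with β | m'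
      · rw [piK_inl_inl]
        split_ifs
        · rw [pm_eq_zero_of_isCombBond hc, Int.cast_zero]
        · rfl
      · rfl
    · rfl
  · rfl

/-- [folklore] **`Πᵀ ∘ axE = Πᵀ`** on the other side: `comp (piK ρ N) (axE ρ N) = piK ρ N` (no comb columns). -/
theorem comp_piK_axE : comp (piK ρ N) (axE ρ N) = piK ρ N := by
  funext x x' a b
  rw [comp_axE_apply']
  rcases b with β | m
  · dsimp only
    split_ifs with hc
    · rcases a with α | m'
      · rw [piK_inl_inl]
        split_ifs
        · rw [pm_eq_zero_of_isCombBond hc, Int.cast_zero]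
        · rfl
      · rfl
    · rfl
  · rfl

end AxE

/-! ## §3 Rules 1–2 of the relative inverse for the co-dressed kernel -/

section Rules

variable {d : ℕ}

/-- [folklore] **RULE 1: `E ∘ G = G`** for `G := coDressKAt (toSite r) N K` and `E := axE (toSite r) N` (in-block root, spread `K`). -/
theorem comp_axE_coDressKAt {N : ℕ} (hN : 1 ≤ N) {r : Fin (d + 1) → ℕ} (hr : r ∈ box (d + 1) N) {K : MKer (d + 1) (Fib d)}
    (hK : Spr K) : comp (axE (toSite r) N) (coDressKAt (toSite r) N K) = coDressKAt (toSite r) N K := by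
  have sE : Spr (axE (d := d) (toSite r) N) := spr_axE _ _
  have sP : Spr (piK (d := d) (toSite r) N) := spr_piK hN hr
  have sPt : Spr (trK (piK (d := d) (toSite r) N)) := spr_trK_piK hN hr
  rw [coDressKAt_eq, comp_assoc_tame sE.tame (spr_comp sPt hK).tame sP.tame, comp_assoc_tame sE.tame sPt.tame hK.tame,
    comp_axE_trK_piK]

/-- [folklore] **RULE 2: `G ∘ E = G`**. -/
theorem comp_coDressKAt_axE {N : ℕ} (hN : 1 ≤ N) {r : Fin (d + 1) → ℕ} (hr : r ∈ box (d + 1) N) {K : MKer (d + 1) (Fib d)}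
    (hK : Spr K) : comp (coDressKAt (toSite r) N K) (axE (toSite r) N) = coDressKAt (toSite r) N K := by
  have sE : Spr (axE (d := d) (toSite r) N) := spr_axE _ _
  have sP : Spr (piK (d := d) (toSite r) N) := spr_piK hN hr
  have sPt : Spr (trK (piK (d := d) (toSite r) N)) := spr_trK_piK hN hr
  rw [coDressKAt_eq, ← comp_assoc_tame (spr_comp sPt hK).tame sP.tame sE.tame, comp_piK_axE]

/-- [folklore] **RULES 1–2 FOR THE CO-DRESSED STEP RESOLVENTS** `G_j := coDressKAt (toSite r) Lc (KInvStep Lc j)`: they live on the range of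
the axial coordinate projector — the first two conjuncts of `ChartConjugationRelative.RelInv G_j 𝕄 (axE (toSite r) Lc)` for ANY `𝕄`.
(Rules 3–4, `(G_j∘𝕄)∘E = E = (E∘𝕄)∘G_j`, are the located open item (ii-1): `𝕄` = the undressed bordered step Hessian.) -/
theorem axE_rules_coDressKAt_KInvStep {Lc : ℕ} [NeZero Lc] {r : Fin (d + 1) → ℕ} (hr : r ∈ box (d + 1) Lc) (j : ℕ) :
    comp (axE (toSite r) Lc) (coDressKAt (toSite r) Lc (OneStepKernelFamily.KInvStep (d := d) Lc j)) =
        coDressKAt (toSite r) Lc (OneStepKernelFamily.KInvStep (d := d) Lc j) ∧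
      comp (coDressKAt (toSite r) Lc (OneStepKernelFamily.KInvStep (d := d) Lc j)) (axE (toSite r) Lc) =
        coDressKAt (toSite r) Lc (OneStepKernelFamily.KInvStep (d := d) Lc j) := by
  obtain ⟨δ, C, hδ, -, hK⟩ := OneStepKernelFamily.decays_KInvStep (d := d) (Lc := Lc) j
  have sK : Spr (OneStepKernelFamily.KInvStep (d := d) Lc j) := ⟨C, δ, hδ, hK⟩
  exact ⟨comp_axE_coDressKAt (one_le_of_neZero Lc) hr sK, comp_coDressKAt_axE (one_le_of_neZero Lc) hr sK⟩

end Rules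

end

end Summit.QuantumFields.BalabanUV.Beta.AxialDressingRooted
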